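import Literature.MathematicalPhysics.QuantumFieldTheory.Balaban1985CMP102.Setting

/-!
# `Summit.QuantumFields.Balaban3D.Proofs.GroupModelEq32` — [Balaban1985UV3] (31) ⇒ (32) p. 264 for the lane's gauge group AS
# TYPED (`Balaban1985CMP102.Setting.GroupModel`: a closed subgroup `G ⊂ U(N)` with semisimple Lie algebra 𝔤), INCLUDING the
# differentiation step «invariance under the global transformations R(U), U ∈ G» ⇒ `ad`-invariance that LQB leaves untyped
# — lane `pub-balaban3d`, seat p4 (PLAN.md §3.1 l.138 «(31)⇒(32) RE-USE `invariant_vector_eq_zero_su`», §0.5 E2, §2.2 B-6)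

HONEST FRAMING (lane PLAN.md §0, binding): see `…Proofs.SectAFirstStep`.  Nothing of [Balaban1985UV3] beyond the quoted
Lie-algebra step is touched; NOT a construction of 𝒫′₁, NOT the representation (33).

WHAT IS PRINTED.  p. 264 = PDF 10 L4–12 (render `…/1985-cmp102-uv-stability-3d/…-p010-x2.png`), verbatim: «The gauge invariance
(26) implies the invariance with respect to the global transformations R(U), U ∈ G, hence the equality
R(U)((δ/δ𝓗(b))𝒫′₁)(g₀, X, 1) = ((δ/δ𝓗(b))𝒫′₁)(g₀, X, 1). (31) … The derivative in the above formula is an element of the Lie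
algebra 𝔤, and by the assumption that 𝔤 is semi-simple, the only element invariant is 0, and we conclude
((δ/δ𝓗(b))𝒫′₁)(g₀, X, 1) = 0. (32) It is the only place we use the semi-simplicity».

WHAT LQB ALREADY HAS (RE-USED BY NAME, not restated): `B10.invariant_vector_eq_zero` — in a semisimple Lie algebra a vector
annihilated by every `ad x` is 0 (Mathlib `LieAlgebra.center_eq_bot`); its docstring records: «The printed hypothesis is
invariance under the adjoint GROUP R(U), U ∈ G; differentiating along one-parameter subgroups gives the `ad`-invariance used
here — that differentiation step is not typed.»  For G = SU(n) concretely: `B12SemisimpleSuN.invariant_vector_eq_zero_su`.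

WHAT THIS FILE PROVES (no `sorry`, axioms standard), for `M : Setting.GroupModel G` (typer-1's spine structure: faithful
unitary realisation `M.ρ : G →* M_N(ℂ)`, `M.lie` = {X : exp(tX) ∈ ρ(G) ∀ t ∈ ℝ} as a real Lie subalgebra of `M_N(ℂ)` with the
commutator bracket, `M.semisimple`):
* §1 `commute_of_forall_exp_commute` — [folklore] calculus: if `exp(tX)·v = v·exp(tX)` for all real `t` then `X·v = v·X`
  (derivative at t = 0 of the identically vanishing `t ↦ exp(tX)v − v exp(tX)`; Mathlib `hasDerivAt_exp_smul_const`);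
* §2 `lie_comm_of_globalInvariant` — THE DIFFERENTIATION STEP: a matrix `v` with `ρ(U)·v = v·ρ(U)` for all `U ∈ G` (the
  printed «invariance with respect to the global transformations R(U), U ∈ G», R(U)v = ρ(U)vρ(U)⁻¹) commutes with every
  `X ∈ 𝔤` (apply §1 to the one-parameter subgroups `exp(tX) ∈ ρ(G)` of `M.mem_lie_iff`);
* §3 `eq32_of_eq31` — **(31) ⇒ (32)**: an element `v ∈ 𝔤` invariant under all `R(U)`, `U ∈ G`, is `0` (§2 + LQB's
  `B10.invariant_vector_eq_zero` at `L = M.lie`, instance `M.semisimple`); `eq32_of_eq31_conj` — the same with the invariance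
  written as conjugation `ρ(U)·v·ρ(U)⋆ = v` (ρ(U) unitary).
So the spine's typing of «a semi-simple compact group Lie G» (Thm 1 p. 257 L5) carries exactly what p. 264 uses.
-/

namespace Summit.QuantumFields.Balaban3D.Proofs.GroupModelEq32

open Literature.MathematicalPhysics.QuantumFieldTheory.Balaban1983to89
open Literature.MathematicalPhysics.QuantumFieldTheory.Balaban1985CMP102.Setting (GroupModel)
open scoped Matrix.Norms.L2Operator


/-! ## §1 Calculus: commuting with a one-parameter group ⇒ commuting with its generator -/

/-- [folklore] If `exp(tX)·v = v·exp(tX)` for every real `t`, then `X·v = v·X`: the function `t ↦ exp(tX)v − v exp(tX)`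
vanishes identically and has derivative `Xv − vX` at `t = 0` (Mathlib `hasDerivAt_exp_smul_const`, composed with `ℝ → ℂ`).
Matrices carry the `L²`-operator norm locally (scope `Matrix.Norms.L2Operator`); the statement is norm-free. [folklore] -/
theorem commute_of_forall_exp_commute {N : ℕ} (X v : Matrix (Fin N) (Fin N) ℂ)
    (h : ∀ t : ℝ, NormedSpace.exp ((t : ℂ) • X) * v = v * NormedSpace.exp ((t : ℂ) • X)) :
    X * v = v * X := by
  -- derivative of `u ↦ exp (u • X)` over `ℂ` at `0`, pulled back to the real line
  have hof : HasDerivAt (fun t : ℝ => (t : ℂ)) 1 0 := by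
    have h0 : HasDerivAt (⇑Complex.ofRealCLM) (Complex.ofRealCLM 1) (0 : ℝ) := Complex.ofRealCLM.hasDerivAt
    rw [Complex.ofRealCLM_apply, Complex.ofReal_one] at h0
    exact h0.congr_of_eventuallyEq (Filter.Eventually.of_forall fun t => (Complex.ofRealCLM_apply t).symm)
  have hF : HasDerivAt ((fun u : ℂ => NormedSpace.exp (u • X)) ∘ fun t : ℝ => (t : ℂ))
      ((1 : ℂ) • (NormedSpace.exp (((0 : ℝ) : ℂ) • X) * X)) 0 :=
    (hasDerivAt_exp_smul_const X ((0 : ℝ) : ℂ)).scomp (0 : ℝ) hof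
  rw [Complex.ofReal_zero, zero_smul, NormedSpace.exp_zero, one_mul, one_smul] at hF
  -- the commutator `t ↦ exp(tX) v − v exp(tX)` has derivative `Xv − vX` at 0 …
  have hG := (hF.mul_const v).sub (hF.const_mul v)
  -- … and vanishes identically by hypothesis
  have hG0 : HasDerivAt (fun _ : ℝ => (0 : Matrix (Fin N) (Fin N) ℂ)) (X * v - v * X) 0 := by
    refine hG.congr_of_eventuallyEq (Filter.Eventually.of_forall fun t => ?_)
    show (0 : Matrix (Fin N) (Fin N) ℂ) =
      NormedSpace.exp ((t : ℂ) • X) * v - v * NormedSpace.exp ((t : ℂ) • X)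
    rw [h t, sub_self]
  exact sub_eq_zero.mp (hG0.unique (hasDerivAt_const (0 : ℝ) (0 : Matrix (Fin N) (Fin N) ℂ)))

/-! ## §2 The differentiation step of p. 264: global `R(U)`-invariance ⇒ `ad`-invariance on 𝔤 -/

variable {G : Type} [GaugeGroup G] [MeasurableSpace G] (M : GroupModel G)

/-- **The untyped step of (31) ⇒ (32)** (p. 264 L5–7 «The derivative in the above formula is an element of the Lie algebra 𝔤,
and by the assumption that 𝔤 is semi-simple, the only element invariant is 0»): a matrix `v` commuting with `ρ(U)` for every
`U ∈ G` — i.e. fixed by the global transformations `R(U)v = ρ(U)vρ(U)⁻¹` of (31) — commutes with every generator `X ∈ 𝔤`,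
because `exp(tX) ∈ ρ(G)` for all real `t` (`GroupModel.mem_lie_iff`, [Hall2015] Def. 3.18) and §1.  Kernel-checked for the
spine's group model. [cite: Balaban1985UV3, (31)–(32) p.264] -/
theorem lie_comm_of_globalInvariant (v : Matrix (Fin M.N) (Fin M.N) ℂ) (hv : ∀ U : G, M.ρ U * v = v * M.ρ U)
    {X : Matrix (Fin M.N) (Fin M.N) ℂ} (hX : X ∈ M.lie) : X * v = v * X := by
  refine commute_of_forall_exp_commute X v fun t => ?_
  obtain ⟨U, hU⟩ := (M.mem_lie_iff X).mp hX t
  rw [← hU]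
  exact hv U

/-! ## §3 (31) ⇒ (32) for the group model -/

/-- **(31) ⇒ (32)** p. 264 = PDF 10 L4–12 for the lane's group AS TYPED: an element `v` of the Lie algebra `𝔤 = M.lie` that is
invariant under the global transformations `R(U)`, `U ∈ G` (here: `ρ(U)·v = v·ρ(U)`, equivalent to `ρ(U)vρ(U)⁻¹ = v`) is `0` —
§2 gives `⁅x, v⁆ = x·v − v·x = 0` for all `x ∈ 𝔤`, and «by the assumption that 𝔤 is semi-simple, the only element invariant is
0» is LQB's `B10.invariant_vector_eq_zero` (Mathlib `LieAlgebra.center_eq_bot`) at `L = M.lie` with the instance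
`M.semisimple`.  «It is the only place we use the semi-simplicity» (p. 264 L9). [cite: Balaban1985UV3, (31)–(32) p.264] -/
theorem eq32_of_eq31 (v : M.lie) (hv : ∀ U : G, M.ρ U * (v : Matrix (Fin M.N) (Fin M.N) ℂ) = v * M.ρ U) : v = 0 := by
  -- the commutator bracket on `M_N(ℂ)`, exactly as in `…Balaban1985CMP102.Setting` (proof-local, so that `M.lie`'s bracket unfolds)
  letI : LieRing (Matrix (Fin M.N) (Fin M.N) ℂ) := LieRing.ofAssociativeRing
  haveI := M.semisimple
  refine B10.invariant_vector_eq_zero (R := ℝ) (L := M.lie) v fun x => ?_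
  have h0 : ((⁅x, v⁆ : M.lie) : Matrix (Fin M.N) (Fin M.N) ℂ) = 0 := by
    rw [LieSubalgebra.coe_bracket, LieRing.of_associative_ring_bracket]
    exact sub_eq_zero.mpr (lie_comm_of_globalInvariant M v hv x.2)
  exact Subtype.ext (h0.trans (ZeroMemClass.coe_zero M.lie).symm)

/-- (31) ⇒ (32) with the invariance written as printed, by CONJUGATION: `R(U)v = ρ(U)·v·ρ(U)⋆ = v` for all `U ∈ G` (ρ(U) is
unitary, `GroupModel.mem_unitary`, so `ρ(U)⋆ = ρ(U)⁻¹`) implies `v = 0` for `v ∈ 𝔤`. [cite: Balaban1985UV3, (31)–(32) p.264] -/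
theorem eq32_of_eq31_conj (v : M.lie)
    (hv : ∀ U : G, M.ρ U * (v : Matrix (Fin M.N) (Fin M.N) ℂ) * star (M.ρ U) = v) : v = 0 := by
  refine eq32_of_eq31 M v fun U => ?_
  have hU := M.mem_unitary U
  have h1 : star (M.ρ U) * M.ρ U = 1 := Matrix.mem_unitaryGroup_iff'.mp hU
  calc M.ρ U * (v : Matrix (Fin M.N) (Fin M.N) ℂ)
      = M.ρ U * v * (star (M.ρ U) * M.ρ U) := by rw [h1, mul_one]
    _ = (M.ρ U * v * star (M.ρ U)) * M.ρ U := by simp only [mul_assoc]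
    _ = v * M.ρ U := by rw [hv U]

end Summit.QuantumFields.Balaban3D.Proofs.GroupModelEq32
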